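import Summits.CriticalPhenomena.PercolationContinuityZ3.Theorems.PercNearOneGluingNoHeavyLowerTailFKExactEval
import Summits.CriticalPhenomena.PercolationContinuityZ3.Theorems.PercNearOneGluingNoHeavyLowerTailFKAnalogues
import HarnessLib

/-!
# Kernel witnesses of the `q`-sensitivity of `φ_{w,q}`: positive association and vdBHK's one-cluster CPA FAIL at `q = 1/2`;
# the law of one edge is NOT local for `q = 2`

Helper file (`--supports stmt-CriticalPhenomena-4575 --as helper`), FK sub-lane `prim-bschramm-fk-3` ("locate the `q`-sensitivity
of the CSH ⇒ AdditiveGluing ⇒ continuity chain under the random-cluster transplant `prodBernoulli w ↦ φ_{w,q}`"); builds on p205010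
(kernel theorem, internal audit signed; external expert review pending).  No named facts, no sorries; standard axioms.  Every number
below is an exact rational decided by the kernel through the bridge `FK.RCEval` (`…FKExactEval.lean`).

All three witnesses live on the triangle `K₃` (vertices `0,1,2`; listed pairs `01, 02, 12` with parameter `1/2`, every other pair
parameter `0`), `8` configurations:

1. **`q = 1/2`: positive association fails** (`FK.rcMeasureW_half_not_posAssoc`).  `φ(01 open) = φ(02 open) = 14/23` but
   `φ(01 and 02 open) = 8/23 < (14/23)² = 196/529` (margin `12/529`): the two increasing edge events are NEGATIVELY correlated.  So the
   hypothesis `1 ≤ q` of the tree's FKG inequality `rcMeasureW_fkg` (Grimmett 2006 Thm. (3.8)) cannot be dropped — Grimmett, §3.9: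
   for `q < 1` "the measure does not satisfy the FKG lattice condition", edges are believed negatively correlated ((3.94)–(3.96)).
2. **`q = 1/2`: van den Berg–Häggström–Kahn's Theorem 1.3 fails** (`FK.not_clusterCPAFK_half : ¬ FK.ClusterCPAFK (1/2)`): with
   `s = 0`, `X = ∅` and the increasing cluster functionals `F = 1{01 ∈ C_0}`, `G = 1{02 ∈ C_0}` (an open edge at `0` IS in the edge
   cluster of `0`), `E[F]E[G] = 196/529 > E[FG] = 8/23`.  So the hypothesis `1 ≤ q` of fk-1's `FK.clusterCPAFK_of_one_le` (the
   printed input of Lemma T and of (S5) ⇒ (GEN) in the finite leg) is SHARP: below `q = 1` the finite leg loses its positive-association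
   input, although its OUTPUT `FK.AdditiveGluingFK q` is census-true for every tested `q > 0` (`FK.AdditiveGluingFKPos`, exact censuses
   of 2026-08-20) — for `q < 1` additive gluing, if true, is not a consequence of one-cluster CPA.
3. **`q = 2`: non-locality** (`FK.rcMeasureW_two_nonlocal`).  Lowering the parameter of the pair `12` from `1/2` to `0` (deleting the
   edge) changes the probability that the OTHER pair `01` is open from `5/14` to `1/3`, although the event `{01 open}` is determined by
   the pair `01` alone and the two parameter vectors agree off `12`; at `q = 1` both probabilities are `1/2`
   (`FK.rcMeasureW_one_local`, the product-measure identity `prodBernoulli_real_eq_of_determinedBy` in miniature).  This is the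
   mechanism behind the located breaks (i)/(iii) of bschramm/FK-BARRIER.md §0 (locality transfer `IsSubbox.real_eq_bondPercolation`,
   restriction identity `theta_induce_eq_real_percolatesVia`): for `q ≠ 1` the law inside a region depends on the parameters outside it
   (Grimmett 2006 Lemma (4.13): only the boundary-condition sandwich survives).
[cite: Grimmett2006, Thm. (3.8) and §3.9 eqs. (3.94)–(3.96); §1.4 eq. (1.20) (p. 15); Lemma (4.13)]
[cite: VandenbergHaggstromKahn2005, Thm. 1.3 (p. 6)]
-/

namespace Summit.CriticalPhenomena.PercolationContinuityZ3.Theorems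

namespace FK

open MeasureTheory Literature.Probability.LatticeModels Literature.Probability.Percolation

namespace QSensitivity

/-! ### The data: `K₃` with parameters `1/2`, and `K₃` with the pair `12` deleted -/

/-- `K₃` on `Fin 3` with listed pairs `01, 02, 12`, parameters `1/2`, cluster weight `q` (reducible, so that `Fin (k3 q).n` is `Fin 3`
for instance search). (transcription of bschramm/FK-BARRIER.md §2) -/
abbrev k3 (q : ℚ) : RCEval := ⟨3, 3, ![0, 0, 1], ![1, 2, 2], fun _ => 1 / 2, q⟩

/-- The same listed pairs with the parameter of `12` lowered to `0` (the path `1 — 0 — 2`; reducible).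
(transcription of bschramm/FK-BARRIER.md §2) -/
abbrev k3del (q : ℚ) : RCEval := ⟨3, 3, ![0, 0, 1], ![1, 2, 2], ![1 / 2, 1 / 2, 0], q⟩

/-! ### Kernel arithmetic (`decide +kernel`, 8 configurations each) -/

/-- Validity of the data at `q = 1/2`. [folklore] -/
theorem k3_half_valid : (k3 (1 / 2)).Valid := by decide +kernel

/-- Validity of the data at `q = 2`. [folklore] -/
theorem k3_two_valid : (k3 2).Valid := by decide +kernel

/-- Validity of the data at `q = 1`. [folklore] -/
theorem k3_one_valid : (k3 1).Valid := by decide +kernel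

/-- Validity of the deleted data at `q = 2`. [folklore] -/
theorem k3del_two_valid : (k3del 2).Valid := by decide +kernel

/-- Validity of the deleted data at `q = 1`. [folklore] -/
theorem k3del_one_valid : (k3del 1).Valid := by decide +kernel

/-- `Z(K₃; 1/2, q = 1/2) = 23/64`. (transcription of bschramm/FK-BARRIER.md §9) -/
theorem zq_half : (k3 (1 / 2)).ZQ = 23 / 64 := by decide +kernel

/-- Mass of `{01 open}` at `q = 1/2`: `7/32` (probability `14/23`). (transcription of bschramm/FK-BARRIER.md §9) -/
theorem mass_half_e0 : (k3 (1 / 2)).massQ (fun t => decide ((0 : Fin 3) ∈ t)) = 7 / 32 := by decide +kernel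

/-- Mass of `{02 open}` at `q = 1/2`: `7/32` (probability `14/23`). (transcription of bschramm/FK-BARRIER.md §9) -/
theorem mass_half_e1 : (k3 (1 / 2)).massQ (fun t => decide ((1 : Fin 3) ∈ t)) = 7 / 32 := by decide +kernel

/-- Mass of `{01 and 02 open}` at `q = 1/2`: `1/8` (probability `8/23`). (transcription of bschramm/FK-BARRIER.md §9) -/
theorem mass_half_e0e1 :
    (k3 (1 / 2)).massQ (fun t => decide ((0 : Fin 3) ∈ t) && decide ((1 : Fin 3) ∈ t)) = 1 / 8 := by decide +kernel

/-- `Z(K₃; 1/2, q = 2) = 7/2`. (transcription of bschramm/FK-BARRIER.md §2) -/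
theorem zq_two : (k3 2).ZQ = 7 / 2 := by decide +kernel

/-- Mass of `{01 open}` at `q = 2`: `5/4` (probability `5/14`). (transcription of bschramm/FK-BARRIER.md §2) -/
theorem mass_two_e0 : (k3 2).massQ (fun t => decide ((0 : Fin 3) ∈ t)) = 5 / 4 := by decide +kernel

/-- `Z(K₃ − 12; 1/2, q = 2) = 9/2`. (transcription of bschramm/FK-BARRIER.md §2) -/
theorem zq_del_two : (k3del 2).ZQ = 9 / 2 := by decide +kernel

/-- Mass of `{01 open}` in `K₃ − 12` at `q = 2`: `3/2` (probability `1/3`). (transcription of bschramm/FK-BARRIER.md §2) -/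
theorem mass_del_two_e0 : (k3del 2).massQ (fun t => decide ((0 : Fin 3) ∈ t)) = 3 / 2 := by decide +kernel

/-- `Z(K₃; 1/2, q = 1) = 1` (product measure). [folklore] -/
theorem zq_one : (k3 1).ZQ = 1 := by decide +kernel

/-- Mass of `{01 open}` at `q = 1`: `1/2`. [folklore] -/
theorem mass_one_e0 : (k3 1).massQ (fun t => decide ((0 : Fin 3) ∈ t)) = 1 / 2 := by decide +kernel

/-- `Z(K₃ − 12; 1/2, q = 1) = 1` (product measure). [folklore] -/
theorem zq_del_one : (k3del 1).ZQ = 1 := by decide +kernel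

/-- Mass of `{01 open}` in `K₃ − 12` at `q = 1`: `1/2`. [folklore] -/
theorem mass_del_one_e0 : (k3del 1).massQ (fun t => decide ((0 : Fin 3) ∈ t)) = 1 / 2 := by decide +kernel

/-! ### From masses to the measure -/

noncomputable section

open scoped Classical

/-- The listed pair `0` of `k3 q` is `01`. [folklore] -/
theorem k3_edge_zero (q : ℚ) : (k3 q).edge 0 = s((0 : Fin 3), 1) := rfl

/-- The listed pair `1` of `k3 q` is `02`. [folklore] -/
theorem k3_edge_one (q : ℚ) : (k3 q).edge 1 = s((0 : Fin 3), 2) := rfl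

/-- The listed pair `0` of `k3del q` is `01`. [folklore] -/
theorem k3del_edge_zero (q : ℚ) : (k3del q).edge 0 = s((0 : Fin 3), 1) := rfl

/-- Membership of `conf t` in `{01 open}` (data `k3`). [folklore] -/
theorem k3_conf_mem_e0 {q : ℚ} (hD : (k3 q).Valid) (t : Finset (Fin 3)) :
    (k3 q).conf t ∈ {ω : BondConfig (Fin 3) | s((0 : Fin 3), 1) ∈ ω} ↔ decide ((0 : Fin 3) ∈ t) = true := by
  rw [decide_eq_true_iff, Set.mem_setOf_eq, ← k3_edge_zero q, RCEval.edge_mem_conf hD]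

/-- Membership of `conf t` in `{02 open}` (data `k3`). [folklore] -/
theorem k3_conf_mem_e1 {q : ℚ} (hD : (k3 q).Valid) (t : Finset (Fin 3)) :
    (k3 q).conf t ∈ {ω : BondConfig (Fin 3) | s((0 : Fin 3), 2) ∈ ω} ↔ decide ((1 : Fin 3) ∈ t) = true := by
  rw [decide_eq_true_iff, Set.mem_setOf_eq, ← k3_edge_one q, RCEval.edge_mem_conf hD]

/-- Membership of `conf t` in `{01 open} ∩ {02 open}` (data `k3`). [folklore] -/
theorem k3_conf_mem_e0e1 {q : ℚ} (hD : (k3 q).Valid) (t : Finset (Fin 3)) :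
    (k3 q).conf t ∈ ({ω : BondConfig (Fin 3) | s((0 : Fin 3), 1) ∈ ω} ∩ {ω | s((0 : Fin 3), 2) ∈ ω}) ↔
      (decide ((0 : Fin 3) ∈ t) && decide ((1 : Fin 3) ∈ t)) = true := by
  rw [Set.mem_inter_iff, k3_conf_mem_e0 hD, k3_conf_mem_e1 hD, Bool.and_eq_true]

/-- Membership of `conf t` in `{01 open}` (data `k3del`). [folklore] -/
theorem k3del_conf_mem_e0 {q : ℚ} (hD : (k3del q).Valid) (t : Finset (Fin 3)) :
    (k3del q).conf t ∈ {ω : BondConfig (Fin 3) | s((0 : Fin 3), 1) ∈ ω} ↔ decide ((0 : Fin 3) ∈ t) = true := by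
  rw [decide_eq_true_iff, Set.mem_setOf_eq, ← k3del_edge_zero q, RCEval.edge_mem_conf hD]

/-- `φ_{K₃,1/2,q=1/2}(01 open) = 14/23`. (transcription of bschramm/FK-BARRIER.md §9) -/
theorem real_half_e0 :
    (rcMeasureW (k3 (1 / 2)).w (1 / 2) ∅).real {ω : BondConfig (Fin 3) | s((0 : Fin 3), 1) ∈ ω} = 14 / 23 := by
  have h := RCEval.real_eq_massQ_div k3_half_valid (k3_conf_mem_e0 k3_half_valid)
  rw [mass_half_e0, zq_half] at h
  have hq : (((k3 (1 / 2)).q : ℚ) : ℝ) = 1 / 2 := by norm_num [k3]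
  rw [hq] at h
  rw [h]; norm_num

/-- `φ_{K₃,1/2,q=1/2}(02 open) = 14/23`. (transcription of bschramm/FK-BARRIER.md §9) -/
theorem real_half_e1 :
    (rcMeasureW (k3 (1 / 2)).w (1 / 2) ∅).real {ω : BondConfig (Fin 3) | s((0 : Fin 3), 2) ∈ ω} = 14 / 23 := by
  have h := RCEval.real_eq_massQ_div k3_half_valid (k3_conf_mem_e1 k3_half_valid)
  rw [mass_half_e1, zq_half] at h
  have hq : (((k3 (1 / 2)).q : ℚ) : ℝ) = 1 / 2 := by norm_num [k3]
  rw [hq] at h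
  rw [h]; norm_num

/-- `φ_{K₃,1/2,q=1/2}(01 and 02 open) = 8/23`. (transcription of bschramm/FK-BARRIER.md §9) -/
theorem real_half_e0e1 :
    (rcMeasureW (k3 (1 / 2)).w (1 / 2) ∅).real
        ({ω : BondConfig (Fin 3) | s((0 : Fin 3), 1) ∈ ω} ∩ {ω | s((0 : Fin 3), 2) ∈ ω}) = 8 / 23 := by
  have h := RCEval.real_eq_massQ_div k3_half_valid (k3_conf_mem_e0e1 k3_half_valid)
  rw [mass_half_e0e1, zq_half] at h
  have hq : (((k3 (1 / 2)).q : ℚ) : ℝ) = 1 / 2 := by norm_num [k3]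
  rw [hq] at h
  rw [h]; norm_num

/-- `φ_{K₃,1/2,q=2}(01 open) = 5/14`. (transcription of bschramm/FK-BARRIER.md §2) -/
theorem real_two_e0 :
    (rcMeasureW (k3 2).w 2 ∅).real {ω : BondConfig (Fin 3) | s((0 : Fin 3), 1) ∈ ω} = 5 / 14 := by
  have h := RCEval.real_eq_massQ_div k3_two_valid (k3_conf_mem_e0 k3_two_valid)
  rw [mass_two_e0, zq_two] at h
  have hq : (((k3 2).q : ℚ) : ℝ) = 2 := by norm_num [k3]
  rw [hq] at h
  rw [h]; norm_num

/-- `φ_{K₃−12,1/2,q=2}(01 open) = 1/3`. (transcription of bschramm/FK-BARRIER.md §2) -/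
theorem real_del_two_e0 :
    (rcMeasureW (k3del 2).w 2 ∅).real {ω : BondConfig (Fin 3) | s((0 : Fin 3), 1) ∈ ω} = 1 / 3 := by
  have h := RCEval.real_eq_massQ_div k3del_two_valid (k3del_conf_mem_e0 k3del_two_valid)
  rw [mass_del_two_e0, zq_del_two] at h
  have hq : (((k3del 2).q : ℚ) : ℝ) = 2 := by norm_num [k3del]
  rw [hq] at h
  rw [h]; norm_num

/-- `φ_{K₃,1/2,q=1}(01 open) = 1/2`. [folklore] -/
theorem real_one_e0 :
    (rcMeasureW (k3 1).w 1 ∅).real {ω : BondConfig (Fin 3) | s((0 : Fin 3), 1) ∈ ω} = 1 / 2 := by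
  have h := RCEval.real_eq_massQ_div k3_one_valid (k3_conf_mem_e0 k3_one_valid)
  rw [mass_one_e0, zq_one] at h
  have hq : (((k3 1).q : ℚ) : ℝ) = 1 := by norm_num [k3]
  rw [hq] at h
  rw [h]; norm_num

/-- `φ_{K₃−12,1/2,q=1}(01 open) = 1/2`. [folklore] -/
theorem real_del_one_e0 :
    (rcMeasureW (k3del 1).w 1 ∅).real {ω : BondConfig (Fin 3) | s((0 : Fin 3), 1) ∈ ω} = 1 / 2 := by
  have h := RCEval.real_eq_massQ_div k3del_one_valid (k3del_conf_mem_e0 k3del_one_valid)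
  rw [mass_del_one_e0, zq_del_one] at h
  have hq : (((k3del 1).q : ℚ) : ℝ) = 1 := by norm_num [k3del]
  rw [hq] at h
  rw [h]; norm_num

/-- The two parameter vectors agree off the pair `12`. [folklore] -/
theorem k3_w_eq_k3del_w {q : ℚ} (h1 : (k3 q).Valid) (h2 : (k3del q).Valid) {e : Sym2 (Fin 3)}
    (he : e ≠ s((1 : Fin 3), 2)) : (k3 q).w e = (k3del q).w e := by
  apply Subtype.ext
  by_cases hr : e ∈ Set.range (k3 q).edge
  · obtain ⟨i, rfl⟩ := hr
    have hedge : (k3 q).edge i = (k3del q).edge i := rfl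
    rw [RCEval.w_edge h1 i, hedge, RCEval.w_edge h2 i]
    fin_cases i
    · rfl
    · rfl
    · exact (he rfl).elim
  · have hr' : e ∉ Set.range (k3del q).edge := hr
    rw [RCEval.w_eq_zero_of_notMem_range hr, RCEval.w_eq_zero_of_notMem_range hr']

end

end QSensitivity

/-! ### The three located statements -/

noncomputable section

open scoped Classical
open QSensitivity

/-- **Positive association FAILS for `φ_{w,q}` with `q = 1/2`**: on `K₃` with parameters `1/2` the increasing events `{01 open}`,
`{02 open}` have `φ(01)φ(02) = 196/529 > φ(01 ∩ 02) = 8/23` — the hypothesis `1 ≤ q` of `rcMeasureW_fkg` (Grimmett 2006 Thm. (3.8))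
is sharp. [cite: Grimmett2006, Thm. (3.8) and §3.9 eqs. (3.94)–(3.96)] -/
theorem rcMeasureW_half_not_posAssoc :
    ¬ ∀ A A' : Set (BondConfig (Fin 3)), IsUpperSet A → IsUpperSet A' →
      (rcMeasureW (k3 (1 / 2)).w (1 / 2) ∅).real A * (rcMeasureW (k3 (1 / 2)).w (1 / 2) ∅).real A' ≤
        (rcMeasureW (k3 (1 / 2)).w (1 / 2) ∅).real (A ∩ A') := by
  intro h
  have hA : IsUpperSet {ω : BondConfig (Fin 3) | s((0 : Fin 3), 1) ∈ ω} := fun _ _ hab ha => hab ha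
  have hA' : IsUpperSet {ω : BondConfig (Fin 3) | s((0 : Fin 3), 2) ∈ ω} := fun _ _ hab ha => hab ha
  have key := h _ _ hA hA'
  rw [real_half_e0, real_half_e1, real_half_e0e1] at key
  norm_num at key

/-- An open non-loop pair at `a` lies in the open edge cluster of `a`. [cite: VandenbergHaggstromKahn2005, §1 p. 3 (definition of C_s)] -/
theorem mk_mem_openEdgeCluster_iff {V : Type*} (ω : BondConfig V) {a b : V} (hab : a ≠ b) :
    s(a, b) ∈ openEdgeCluster ω a ↔ s(a, b) ∈ ω := by
  refine ⟨fun h => h.1, fun h => ⟨h, by rwa [Sym2.mk_isDiag_iff], fun v hv => ?_⟩⟩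
  rcases Sym2.mem_iff.1 hv with rfl | rfl
  · exact SimpleGraph.Reachable.refl _
  · exact SimpleGraph.Adj.reachable ((openGraph_adj ω _ _).2 ⟨h, hab⟩)

/-- **van den Berg–Häggström–Kahn's Theorem 1.3 FAILS for `φ_{w,q}` with `q = 1/2`: `¬ FK.ClusterCPAFK (1/2)`.**  Witness: `K₃`,
parameters `1/2`, `s = 0`, `X = ∅`, `F = 1{01 ∈ C_0}`, `G = 1{02 ∈ C_0}`: `E[F]E[G] = 196/529 > 1 · E[FG] = 8/23`.  So `1 ≤ q` in
`FK.clusterCPAFK_of_one_le` is sharp: the positive-association input of the finite leg (Lemma T, (S5) ⇒ (GEN)) is lost below `q = 1`.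
[cite: VandenbergHaggstromKahn2005, Thm. 1.3 (p. 6)] [cite: Grimmett2006, §3.9 eqs. (3.94)–(3.96)] -/
theorem not_clusterCPAFK_half : ¬ ClusterCPAFK (1 / 2) := by
  intro h
  set μ := rcMeasureW (k3 (1 / 2)).w (1 / 2) ∅ with hμ
  let F : Set (Sym2 (Fin 3)) → ℝ := fun S => if s((0 : Fin 3), 1) ∈ S then 1 else 0
  let G : Set (Sym2 (Fin 3)) → ℝ := fun S => if s((0 : Fin 3), 2) ∈ S then 1 else 0
  have hmono : ∀ e : Sym2 (Fin 3), Monotone (fun S : Set (Sym2 (Fin 3)) => if e ∈ S then (1 : ℝ) else 0) := by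
    intro e S T hST
    dsimp only
    by_cases hS : e ∈ S
    · rw [if_pos hS, if_pos (hST hS)]
    · rw [if_neg hS]; split_ifs <;> norm_num
  have key := h 3 (k3 (1 / 2)).w 0 ∅ F G (hmono _) (hmono _) (Set.notMem_empty _)
  have hD : {ω : BondConfig (Fin 3) | ∀ x ∈ (∅ : Set (Fin 3)), ¬ (openGraph ω).Reachable 0 x} = Set.univ :=
    Set.eq_univ_of_forall fun ω x hx => (Set.notMem_empty x hx).elim
  rw [hD, Measure.restrict_univ] at key
  have hq : (((k3 (1 / 2)).q : ℚ) : ℝ) = 1 / 2 := by norm_num [k3]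
  haveI : IsProbabilityMeasure μ := isProbabilityMeasure_rcMeasureW _ (by norm_num) ∅
  -- the three integrals
  have hF : ∀ t : Finset (Fin 3), F (openEdgeCluster ((k3 (1 / 2)).conf t) 0) =
      if decide ((0 : Fin 3) ∈ t) then (1 : ℝ) else 0 := by
    intro t
    have h01 : s((0 : Fin 3), 1) ∈ openEdgeCluster ((k3 (1 / 2)).conf t) 0 ↔ decide ((0 : Fin 3) ∈ t) = true := by
      rw [mk_mem_openEdgeCluster_iff _ (by decide)]; exact k3_conf_mem_e0 k3_half_valid t
    dsimp only [F]
    by_cases ht : decide ((0 : Fin 3) ∈ t) = true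
    · rw [if_pos (h01.2 ht), if_pos ht]
    · rw [if_neg (fun h' => ht (h01.1 h')), if_neg ht]
  have hG : ∀ t : Finset (Fin 3), G (openEdgeCluster ((k3 (1 / 2)).conf t) 0) =
      if decide ((1 : Fin 3) ∈ t) then (1 : ℝ) else 0 := by
    intro t
    have h02 : s((0 : Fin 3), 2) ∈ openEdgeCluster ((k3 (1 / 2)).conf t) 0 ↔ decide ((1 : Fin 3) ∈ t) = true := by
      rw [mk_mem_openEdgeCluster_iff _ (by decide)]; exact k3_conf_mem_e1 k3_half_valid t
    dsimp only [G]
    by_cases ht : decide ((1 : Fin 3) ∈ t) = true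
    · rw [if_pos (h02.2 ht), if_pos ht]
    · rw [if_neg (fun h' => ht (h02.1 h')), if_neg ht]
  have hIF : ∫ ω, F (openEdgeCluster ω 0) ∂μ = 14 / 23 := by
    have h1 := RCEval.integral_eq_sum_div k3_half_valid (fun ω => F (openEdgeCluster ω 0))
    rw [hq] at h1
    rw [hμ, h1]
    simp only [hF]
    rw [RCEval.sum_mQ_mul_ite (D := k3 (1 / 2)) (P := fun t => decide ((0 : Fin 3) ∈ t)), mass_half_e0, zq_half]
    norm_num
  have hIG : ∫ ω, G (openEdgeCluster ω 0) ∂μ = 14 / 23 := by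
    have h1 := RCEval.integral_eq_sum_div k3_half_valid (fun ω => G (openEdgeCluster ω 0))
    rw [hq] at h1
    rw [hμ, h1]
    simp only [hG]
    rw [RCEval.sum_mQ_mul_ite (D := k3 (1 / 2)) (P := fun t => decide ((1 : Fin 3) ∈ t)), mass_half_e1, zq_half]
    norm_num
  have hIFG : ∫ ω, F (openEdgeCluster ω 0) * G (openEdgeCluster ω 0) ∂μ = 8 / 23 := by
    have h1 := RCEval.integral_eq_sum_div k3_half_valid (fun ω => F (openEdgeCluster ω 0) * G (openEdgeCluster ω 0))
    rw [hq] at h1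
    rw [hμ, h1]
    have hFG : ∀ t : Finset (Fin 3),
        F (openEdgeCluster ((k3 (1 / 2)).conf t) 0) * G (openEdgeCluster ((k3 (1 / 2)).conf t) 0) =
          if (decide ((0 : Fin 3) ∈ t) && decide ((1 : Fin 3) ∈ t)) then (1 : ℝ) else 0 := by
      intro t
      rw [hF, hG]
      cases decide ((0 : Fin 3) ∈ t) <;> cases decide ((1 : Fin 3) ∈ t) <;> simp
    simp only [hFG]
    rw [RCEval.sum_mQ_mul_ite (D := k3 (1 / 2)) (P := fun t => decide ((0 : Fin 3) ∈ t) && decide ((1 : Fin 3) ∈ t)),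
      mass_half_e0e1, zq_half]
    norm_num
  rw [hIF, hIG, hIFG, probReal_univ] at key
  norm_num at key

/-- **Non-locality of `φ_{w,2}`**: on `Fin 3`, the parameter vectors of `K₃` (all `1/2`) and of `K₃` with the pair `12` lowered to `0`
agree off `12`, yet the probability that the pair `01` is open is `5/14` under the first and `1/3` under the second — for `q ≠ 1` the
law of a region depends on the parameters outside it (the mechanism of the located breaks (i) locality transfer / (iii) restriction
identity of bschramm/FK-BARRIER.md §0; Grimmett 2006 Lemma (4.13)).  Contrast: `rcMeasureW_one_local` (`q = 1`).
[cite: Grimmett2006, Lemma (4.13) and §1.4 eq. (1.20)] -/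
theorem rcMeasureW_two_nonlocal :
    (∀ e : Sym2 (Fin 3), e ≠ s((1 : Fin 3), 2) → (k3 2).w e = (k3del 2).w e) ∧
    (rcMeasureW (k3 2).w 2 ∅).real {ω : BondConfig (Fin 3) | s((0 : Fin 3), 1) ∈ ω} = 5 / 14 ∧
    (rcMeasureW (k3del 2).w 2 ∅).real {ω : BondConfig (Fin 3) | s((0 : Fin 3), 1) ∈ ω} = 1 / 3 :=
  ⟨fun _ he => k3_w_eq_k3del_w k3_two_valid k3del_two_valid he, real_two_e0, real_del_two_e0⟩

/-- **Locality at `q = 1`** (the product measure, `rcMeasureW_one`): with the same two parameter vectors the probability that `01` is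
open is `1/2` under both — the identity `prodBernoulli_real_eq_of_determinedBy` that the `q = 1` chain uses and `φ_{w,q}`, `q ≠ 1`,
lacks (`rcMeasureW_two_nonlocal`). [cite: Grimmett2006, §1.4 eq. (1.20) (q = 1 is the product measure)] -/
theorem rcMeasureW_one_local :
    (∀ e : Sym2 (Fin 3), e ≠ s((1 : Fin 3), 2) → (k3 1).w e = (k3del 1).w e) ∧
    (rcMeasureW (k3 1).w 1 ∅).real {ω : BondConfig (Fin 3) | s((0 : Fin 3), 1) ∈ ω} = 1 / 2 ∧
    (rcMeasureW (k3del 1).w 1 ∅).real {ω : BondConfig (Fin 3) | s((0 : Fin 3), 1) ∈ ω} = 1 / 2 :=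
  ⟨fun _ he => k3_w_eq_k3del_w k3_one_valid k3del_one_valid he, real_one_e0, real_del_one_e0⟩

end

end FK

end Summit.CriticalPhenomena.PercolationContinuityZ3.Theorems
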